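import Summits.CriticalPhenomena.PercolationContinuityZ3.Theorems.PercNearOneGluingNoHeavyLowerTailThreeSumPointwise
import Summits.CriticalPhenomena.PercolationContinuityZ3.Theorems.PercNearOneGluingNoHeavyLowerTailGZHub
import Literature.Probability.Percolation.TwoClusterGibbsCovariance
import HarnessLib

/-!
# `NoHeavyLowerTail` (stmt-CriticalPhenomena-4575) — the 3-sum theorem for R1, measure level, part 5:
# the cell masses of the glued random-cluster measure are bilinear forms in the pieces' wired cell masses

Support file (prover prim-gen-kcluster gen 71; `--supports stmt-CriticalPhenomena-4575`).  No definitions, no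
named facts, no sorries.  Blueprint KCLUSTER-gen69.md §9 (N3b), steps (4)–(5) and the dictionary (7).

SETTING as in parts 3–4: distinct terminals `a b c`, supports `DA DB` meeting only in `{a,b,c}`, parameters
`w` vanishing off `DA ∪ DB`, piece parameters `wA` (`= w` on `DA`, `0` off `DA`) and `wB` (`= w` off `DA`,
`0` on `DA`), any real `q`, `T = {a,b,c}`.  The `T`-WIRED unnormalised cell masses of piece `P` are
`R_P(σ) = Σ_η rcWeightW w_P q T η · 1_σ(η)` (`σ` a three-point cell: `c = abc`, `b = ab|c`, `g = ac|b`,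
`n = a|bc`, `z = a|b|c`, `s = S_{D_P}` the separating cell) and `M_P = Σ_η rcWeightW w_P q T η` the wired
partition function.

* `ThreeSum.sum_weight_inter_mul_sdiff` — independence of the two blocks under the product part of the
  weight: `Σ_ω weight_w(ω) F(ω ∩ DA) G(ω ∖ DA) = (Σ_η weight_{wA} F)(Σ_η weight_{wB} G)`
  (`BHK2006.blockFubini`, `BHK2006.integral_comp_sdiff_prodBernoulli'`).
* THE DICTIONARY (`Z φ(·)` = unnormalised mass under `φ = rcMeasureW w q ∅`, `K = q^{k^T(∅)}`):
  `ThreeSum.glued_T_sum`:  `K·Zφ(abc) = R_A(c) M_B + M_A R_B(c) − R_A(c)R_B(c) + R_A(n)(R_B(b)+R_B(g))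
                                         + (R_A(b)+R_A(g)) R_B(n) + R_A(b) R_B(g) + R_A(g) R_B(b)`,
  `ThreeSum.glued_Ub_sum`: `K·Zφ(ab|c) = q (R_A(b) R_B(z) + R_A(z) R_B(b) + R_A(b) R_B(b))`,
  `ThreeSum.glued_Uc_sum`: `K·Zφ(ac|b) = q (R_A(g) R_B(z) + R_A(z) R_B(g) + R_A(g) R_B(g))`,
  `ThreeSum.glued_S_sum`:  `K·Zφ(S_{DA∪DB}) = q² R_A(s) R_B(s)`.
Part 6 feeds these, with the piece hypotheses R1/LB/LG rewritten in the same masses, into the algebraic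
certificate `WheelR1.wheel_certificate` (p375044) to conclude the measure-level 3-sum theorem.
-/

noncomputable section

namespace Summit.CriticalPhenomena.PercolationContinuityZ3.Theorems

namespace ThreeSum

open Finset SimpleGraph Literature.Probability.Percolation Literature.Probability.Percolation.Gladkov
open Literature.Probability.Percolation.BHK2006 (weight blockFubini integral_prodBernoulli_eq_sum)
open Literature.Probability.Percolation.DecisionTree (ind ind_of_mem ind_of_not_mem)
open Literature.Probability.LatticeModels RefinedRowR3 ThreePointLB MeasureTheory
open scoped Classical

variable {V : Type*} [Fintype V]

/-! ### Independence of the two pieces under the product part of the weight -/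

/-- **Independence of the pieces (product part).**  If `wA` is `w` on `DA` and `0` off `DA`, and `wB` is `w`
off `DA` and `0` on `DA`, then for all `F, G`:
`Σ_ω weight_w(ω) F(ω ∩ DA) G(ω ∖ DA) = (Σ_η weight_{wA}(η) F(η)) · (Σ_η weight_{wB}(η) G(η))`. [folklore] -/
theorem sum_weight_inter_mul_sdiff (w wA wB : Sym2 V → unitInterval) (DA : Set (Sym2 V))
    (hA : ∀ e ∈ DA, wA e = w e) (hA' : ∀ e ∉ DA, wA e = 0)
    (hB : ∀ e ∈ DA, wB e = 0) (hB' : ∀ e ∉ DA, wB e = w e) (F G : Set (Sym2 V) → ℝ) :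
    ∑ ω : Set (Sym2 V), weight (fun e => (w e : ℝ)) ω * (F (ω ∩ DA) * G (ω \ DA)) =
      (∑ η : Set (Sym2 V), weight (fun e => (wA e : ℝ)) η * F η) *
        ∑ η : Set (Sym2 V), weight (fun e => (wB e : ℝ)) η * G η := by
  have hfub := blockFubini (fun e => (w e : ℝ)) DA (fun x y => F x * G y)
  rw [GZHub.sum_weight, one_mul] at hfub
  rw [hfub]
  -- inner sums: the `DAᶜ`-block is a fresh configuration with parameters `wB`
  have hin : ∀ ω : Set (Sym2 V), ∑ ω', weight (fun e => (w e : ℝ)) ω' * (F (ω ∩ DA) * G (ω' \ DA)) =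
      F (ω ∩ DA) * ∑ η : Set (Sym2 V), weight (fun e => (wB e : ℝ)) η * G η := by
    intro ω
    have h2 : ∑ ω', weight (fun e => (w e : ℝ)) ω' * G (ω' \ DA) =
        ∑ η : Set (Sym2 V), weight (fun e => (wB e : ℝ)) η * G η := by
      rw [← integral_prodBernoulli_eq_sum, ← integral_prodBernoulli_eq_sum]
      exact BHK2006.integral_comp_sdiff_prodBernoulli' w wB DA hB hB' G
    rw [← h2, Finset.mul_sum]
    exact Finset.sum_congr rfl fun ω' _ => by ring
  simp_rw [hin]
  rw [show (∑ x : Set (Sym2 V), weight (fun e => (w e : ℝ)) x *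
      (F (x ∩ DA) * ∑ η : Set (Sym2 V), weight (fun e => (wB e : ℝ)) η * G η)) =
      (∑ x : Set (Sym2 V), weight (fun e => (w e : ℝ)) x * F (x ∩ DA)) *
        ∑ η : Set (Sym2 V), weight (fun e => (wB e : ℝ)) η * G η by
    rw [Finset.sum_mul]; exact Finset.sum_congr rfl fun x _ => by ring]
  congr 1
  -- outer sum: the `DA`-block is a fresh configuration with parameters `wA`
  have h3 : ∑ ω : Set (Sym2 V), weight (fun e => (w e : ℝ)) ω * F (ω \ DAᶜ) =
      ∑ η : Set (Sym2 V), weight (fun e => (wA e : ℝ)) η * F η := by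
    rw [← integral_prodBernoulli_eq_sum, ← integral_prodBernoulli_eq_sum]
    exact BHK2006.integral_comp_sdiff_prodBernoulli' w wA DAᶜ (fun e he => hA' e he)
      (fun e he => hA e (not_not.1 he)) F
  rw [← h3]
  exact Finset.sum_congr rfl fun ω _ => by rw [Set.sdiff_compl]


/-! ### From product-weight sums to wired random-cluster masses -/

/-- `Σ_η weight(η) · (1_E(η) q^{k^T(η)}) = Σ_η rcWeightW q T η · 1_E(η)`. [folklore] -/
theorem sum_weight_ind_pow (u : Sym2 V → unitInterval) (q : ℝ) (B : Set V) (E : Set (BondConfig V)) :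
    ∑ η : BondConfig V, weight (fun e => (u e : ℝ)) η * (ind E η * q ^ clusterCount η B) =
      ∑ η : BondConfig V, rcWeightW u q B η * ind E η := by
  refine Finset.sum_congr rfl fun η _ => ?_
  unfold rcWeightW; ring

/-- `Σ_η weight(η) · ((1_E + 1_E')(η) q^{k^T(η)}) = Σ rcWeightW·1_E + Σ rcWeightW·1_{E'}`. [folklore] -/
theorem sum_weight_ind_add_pow (u : Sym2 V → unitInterval) (q : ℝ) (B : Set V) (E E' : Set (BondConfig V)) :
    ∑ η : BondConfig V, weight (fun e => (u e : ℝ)) η * ((ind E η + ind E' η) * q ^ clusterCount η B) =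
      (∑ η : BondConfig V, rcWeightW u q B η * ind E η) + ∑ η : BondConfig V, rcWeightW u q B η * ind E' η := by
  rw [← Finset.sum_add_distrib]
  refine Finset.sum_congr rfl fun η _ => ?_
  unfold rcWeightW; ring

/-- `Σ_η weight(η) · q^{k^T(η)} = Σ_η rcWeightW q T η` (the wired partition function). [folklore] -/
theorem sum_weight_pow (u : Sym2 V → unitInterval) (q : ℝ) (B : Set V) :
    ∑ η : BondConfig V, weight (fun e => (u e : ℝ)) η * q ^ clusterCount η B =
      ∑ η : BondConfig V, rcWeightW u q B η := by
  refine Finset.sum_congr rfl fun η _ => ?_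
  unfold rcWeightW; ring

/-! ### The dictionary -/

section Sums

variable {DA DB : Finset (Sym2 V)} {a b c : V} (hab : a ≠ b) (hac : a ≠ c) (hbc : b ≠ c)
  (hsepD : ∀ v : V, (∃ e ∈ DA, v ∈ e) → (∃ e ∈ DB, v ∈ e) → (v = a ∨ v = b ∨ v = c))
  (w wA wB : Sym2 V → unitInterval) (q : ℝ) (hw : ∀ e, e ∉ (↑DA ∪ ↑DB : Set (Sym2 V)) → (w e : ℝ) = 0)
  (hA : ∀ e ∈ (↑DA : Set (Sym2 V)), wA e = w e) (hA' : ∀ e ∉ (↑DA : Set (Sym2 V)), wA e = 0)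
  (hB : ∀ e ∈ (↑DA : Set (Sym2 V)), wB e = 0) (hB' : ∀ e ∉ (↑DA : Set (Sym2 V)), wB e = w e)
include hab hac hbc hsepD hw hA hA' hB hB'

/-- **Dictionary, separating cell**: `K · Zφ(S_{DA∪DB}) = q² · R_A(s) R_B(s)`. [this work] -/
theorem glued_S_sum :
    (∑ ω : BondConfig V, rcWeightW w q ∅ ω * ind {η : BondConfig V | b ∉ cl η.toFinset a ∧ c ∉ cl η.toFinset a ∧ Sep (DA ∪ DB) (cl η.toFinset a) b c} ω) * q ^ clusterCount (∅ : BondConfig V) ({a, b, c} : Set V) =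
      q ^ 2 * ((∑ η : BondConfig V, rcWeightW wA q ({a, b, c} : Set V) η * ind {η : BondConfig V | b ∉ cl η.toFinset a ∧ c ∉ cl η.toFinset a ∧ Sep DA (cl η.toFinset a) b c} η) * (∑ η : BondConfig V, rcWeightW wB q ({a, b, c} : Set V) η * ind {η : BondConfig V | b ∉ cl η.toFinset a ∧ c ∉ cl η.toFinset a ∧ Sep DB (cl η.toFinset a) b c} η)) := by
  rw [Finset.sum_mul, Finset.sum_congr rfl fun ω _ => pt_S hab hac hbc hsepD w q hw ω]
  have e1 := sum_weight_inter_mul_sdiff w wA wB (↑DA) hA hA' hB hB'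
    (fun x => ind {η : BondConfig V | b ∉ cl η.toFinset a ∧ c ∉ cl η.toFinset a ∧ Sep DA (cl η.toFinset a) b c} x * q ^ clusterCount x ({a, b, c} : Set V)) (fun y => ind {η : BondConfig V | b ∉ cl η.toFinset a ∧ c ∉ cl η.toFinset a ∧ Sep DB (cl η.toFinset a) b c} y * q ^ clusterCount y ({a, b, c} : Set V))
  beta_reduce at e1
  rw [← sum_weight_ind_pow wA, ← sum_weight_ind_pow wB, ← e1, Finset.mul_sum]
  refine Finset.sum_congr rfl fun ω _ => by ring

/-- **Dictionary, cell `ab|c`**: `K · Zφ(ab|c) = q · (R_A R_B(z) + R_A(z) R_B + R_A R_B)` (`z = a|b|c`). [this work] -/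
theorem glued_Ub_sum :
    (∑ ω : BondConfig V, rcWeightW w q ∅ ω * ind {η : BondConfig V | b ∈ cl η.toFinset a ∧ c ∉ cl η.toFinset a} ω) * q ^ clusterCount (∅ : BondConfig V) ({a, b, c} : Set V) =
      q * ((∑ η : BondConfig V, rcWeightW wA q ({a, b, c} : Set V) η * ind {η : BondConfig V | b ∈ cl η.toFinset a ∧ c ∉ cl η.toFinset a} η) * (∑ η : BondConfig V, rcWeightW wB q ({a, b, c} : Set V) η * ind {η : BondConfig V | b ∉ cl η.toFinset a ∧ c ∉ cl η.toFinset a ∧ c ∉ cl η.toFinset b} η) + (∑ η : BondConfig V, rcWeightW wA q ({a, b, c} : Set V) η * ind {η : BondConfig V | b ∉ cl η.toFinset a ∧ c ∉ cl η.toFinset a ∧ c ∉ cl η.toFinset b} η) * (∑ η : BondConfig V, rcWeightW wB q ({a, b, c} : Set V) η * ind {η : BondConfig V | b ∈ cl η.toFinset a ∧ c ∉ cl η.toFinset a} η) + (∑ η : BondConfig V, rcWeightW wA q ({a, b, c} : Set V) η * ind {η : BondConfig V | b ∈ cl η.toFinset a ∧ c ∉ cl η.toFinset a} η) * (∑ η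 : BondConfig V, rcWeightW wB q ({a, b, c} : Set V) η * ind {η : BondConfig V | b ∈ cl η.toFinset a ∧ c ∉ cl η.toFinset a} η)) := by
  rw [Finset.sum_mul, Finset.sum_congr rfl fun ω _ => pt_Ub hab hac hbc hsepD w q hw ω]
  have e1 := sum_weight_inter_mul_sdiff w wA wB (↑DA) hA hA' hB hB'
    (fun x => ind {η : BondConfig V | b ∈ cl η.toFinset a ∧ c ∉ cl η.toFinset a} x * q ^ clusterCount x ({a, b, c} : Set V)) (fun y => ind {η : BondConfig V | b ∉ cl η.toFinset a ∧ c ∉ cl η.toFinset a ∧ c ∉ cl η.toFinset b} y * q ^ clusterCount y ({a, b, c} : Set V))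
  have e2 := sum_weight_inter_mul_sdiff w wA wB (↑DA) hA hA' hB hB'
    (fun x => ind {η : BondConfig V | b ∉ cl η.toFinset a ∧ c ∉ cl η.toFinset a ∧ c ∉ cl η.toFinset b} x * q ^ clusterCount x ({a, b, c} : Set V)) (fun y => ind {η : BondConfig V | b ∈ cl η.toFinset a ∧ c ∉ cl η.toFinset a} y * q ^ clusterCount y ({a, b, c} : Set V))
  have e3 := sum_weight_inter_mul_sdiff w wA wB (↑DA) hA hA' hB hB'
    (fun x => ind {η : BondConfig V | b ∈ cl η.toFinset a ∧ c ∉ cl η.toFinset a} x * q ^ clusterCount x ({a, b, c} : Set V)) (fun y => ind {η : BondConfig V | b ∈ cl η.toFinset a ∧ c ∉ cl η.toFinset a} y * q ^ clusterCount y ({a, b, c} : Set V))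
  beta_reduce at e1 e2 e3
  rw [← sum_weight_ind_pow wA q _ {η : BondConfig V | b ∈ cl η.toFinset a ∧ c ∉ cl η.toFinset a}, ← sum_weight_ind_pow wA q _ {η : BondConfig V | b ∉ cl η.toFinset a ∧ c ∉ cl η.toFinset a ∧ c ∉ cl η.toFinset b},
    ← sum_weight_ind_pow wB q _ {η : BondConfig V | b ∉ cl η.toFinset a ∧ c ∉ cl η.toFinset a ∧ c ∉ cl η.toFinset b}, ← sum_weight_ind_pow wB q _ {η : BondConfig V | b ∈ cl η.toFinset a ∧ c ∉ cl η.toFinset a}, ← e1, ← e2, ← e3,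
    ← Finset.sum_add_distrib, ← Finset.sum_add_distrib, Finset.mul_sum]
  refine Finset.sum_congr rfl fun ω _ => by ring

/-- **Dictionary, cell `ac|b`**: `K · Zφ(ac|b) = q · (R_A R_B(z) + R_A(z) R_B + R_A R_B)` (`z = a|b|c`). [this work] -/
theorem glued_Uc_sum :
    (∑ ω : BondConfig V, rcWeightW w q ∅ ω * ind {η : BondConfig V | b ∉ cl η.toFinset a ∧ c ∈ cl η.toFinset a} ω) * q ^ clusterCount (∅ : BondConfig V) ({a, b, c} : Set V) =
      q * ((∑ η : BondConfig V, rcWeightW wA q ({a, b, c} : Set V) η * ind {η : BondConfig V | b ∉ cl η.toFinset a ∧ c ∈ cl η.toFinset a} η) * (∑ η : BondConfig V, rcWeightW wB q ({a, b, c} : Set V) η * ind {η : BondConfig V | b ∉ cl η.toFinset a ∧ c ∉ cl η.toFinset a ∧ c ∉ cl η.toFinset b} η) + (∑ η : BondConfig V, rcWeightW wA q ({a, b, c} : Set V) η * ind {η : BondConfig V | b ∉ cl η.toFinset a ∧ c ∉ cl η.toFinset a ∧ c ∉ cl η.toFinset b} η) * (∑ η : BondConfig V, rcWeightW wB q ({a,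 b, c} : Set V) η * ind {η : BondConfig V | b ∉ cl η.toFinset a ∧ c ∈ cl η.toFinset a} η) + (∑ η : BondConfig V, rcWeightW wA q ({a, b, c} : Set V) η * ind {η : BondConfig V | b ∉ cl η.toFinset a ∧ c ∈ cl η.toFinset a} η) * (∑ η : BondConfig V, rcWeightW wB q ({a, b, c} : Set V) η * ind {η : BondConfig V | b ∉ cl η.toFinset a ∧ c ∈ cl η.toFinset a} η)) := by
  rw [Finset.sum_mul, Finset.sum_congr rfl fun ω _ => pt_Uc hab hac hbc hsepD w q hw ω]
  have e1 := sum_weight_inter_mul_sdiff w wA wB (↑DA) hA hA' hB hB'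
    (fun x => ind {η : BondConfig V | b ∉ cl η.toFinset a ∧ c ∈ cl η.toFinset a} x * q ^ clusterCount x ({a, b, c} : Set V)) (fun y => ind {η : BondConfig V | b ∉ cl η.toFinset a ∧ c ∉ cl η.toFinset a ∧ c ∉ cl η.toFinset b} y * q ^ clusterCount y ({a, b, c} : Set V))
  have e2 := sum_weight_inter_mul_sdiff w wA wB (↑DA) hA hA' hB hB'
    (fun x => ind {η : BondConfig V | b ∉ cl η.toFinset a ∧ c ∉ cl η.toFinset a ∧ c ∉ cl η.toFinset b} x * q ^ clusterCount x ({a, b, c} : Set V)) (fun y => ind {η : BondConfig V | b ∉ cl η.toFinset a ∧ c ∈ cl η.toFinset a} y * q ^ clusterCount y ({a, b, c} : Set V))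
  have e3 := sum_weight_inter_mul_sdiff w wA wB (↑DA) hA hA' hB hB'
    (fun x => ind {η : BondConfig V | b ∉ cl η.toFinset a ∧ c ∈ cl η.toFinset a} x * q ^ clusterCount x ({a, b, c} : Set V)) (fun y => ind {η : BondConfig V | b ∉ cl η.toFinset a ∧ c ∈ cl η.toFinset a} y * q ^ clusterCount y ({a, b, c} : Set V))
  beta_reduce at e1 e2 e3
  rw [← sum_weight_ind_pow wA q _ {η : BondConfig V | b ∉ cl η.toFinset a ∧ c ∈ cl η.toFinset a}, ← sum_weight_ind_pow wA q _ {η : BondConfig V | b ∉ cl η.toFinset a ∧ c ∉ cl η.toFinset a ∧ c ∉ cl η.toFinset b},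
    ← sum_weight_ind_pow wB q _ {η : BondConfig V | b ∉ cl η.toFinset a ∧ c ∉ cl η.toFinset a ∧ c ∉ cl η.toFinset b}, ← sum_weight_ind_pow wB q _ {η : BondConfig V | b ∉ cl η.toFinset a ∧ c ∈ cl η.toFinset a}, ← e1, ← e2, ← e3,
    ← Finset.sum_add_distrib, ← Finset.sum_add_distrib, Finset.mul_sum]
  refine Finset.sum_congr rfl fun ω _ => by ring

/-- **Dictionary, cell `abc`**: `K · Zφ(abc) = R_A(c) M_B + M_A R_B(c) − R_A(c) R_B(c) + R_A(n)(R_B(b) + R_B(g))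
+ (R_A(b) + R_A(g)) R_B(n) + R_A(b) R_B(g) + R_A(g) R_B(b)`. [this work] -/
theorem glued_T_sum :
    (∑ ω : BondConfig V, rcWeightW w q ∅ ω * ind {η : BondConfig V | b ∈ cl η.toFinset a ∧ c ∈ cl η.toFinset a} ω) * q ^ clusterCount (∅ : BondConfig V) ({a, b, c} : Set V) =
      (∑ η : BondConfig V, rcWeightW wA q ({a, b, c} : Set V) η * ind {η : BondConfig V | b ∈ cl η.toFinset a ∧ c ∈ cl η.toFinset a} η) * (∑ η : BondConfig V, rcWeightW wB q ({a, b, c} : Set V) η) + (∑ η : BondConfig V, rcWeightW wA q ({a, b, c} : Set V) η) * (∑ η : BondConfig V, rcWeightW wB q ({a, b, c} : Set V) η * ind {η : BondConfig V | b ∈ cl η.toFinset a ∧ c ∈ cl η.toFinset a} η) - (∑ η : BondConfig V, rcWeightW wA q ({a, b, c} : Set V) η * ind {η : BondConfig V | b ∈ cl η.toFinset a ∧ c ∈ cl η.toFinset a} η) * (∑ η : BondConfig V, rcWeightW wB q ({a, b, c} : Set V) η * ind {η : BondConfig V | b ∈ cl η.toFinset a ∧ c ∈ cl η.toFinset a}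 η) + (∑ η : BondConfig V, rcWeightW wA q ({a, b, c} : Set V) η * ind {η : BondConfig V | b ∉ cl η.toFinset a ∧ c ∉ cl η.toFinset a ∧ c ∈ cl η.toFinset b} η) * ((∑ η : BondConfig V, rcWeightW wB q ({a, b, c} : Set V) η * ind {η : BondConfig V | b ∈ cl η.toFinset a ∧ c ∉ cl η.toFinset a} η) + (∑ η : BondConfig V, rcWeightW wB q ({a, b, c} : Set V) η * ind {η : BondConfig V | b ∉ cl η.toFinset a ∧ c ∈ cl η.toFinset a} η)) + ((∑ η : BondConfig V, rcWeightW wA q ({a, b, c} : Set V) η * ind {η : BondConfig V | b ∈ cl η.toFinset a ∧ c ∉ cl η.toFinset a} η) + (∑ η : BondConfig V, rcWeightW wA q ({a, b, c} : Set V) η * ind {η : BondConfig V | b ∉ cl η.toFinset a ∧ c ∈ cl η.toFinset a} η)) * (∑ η : BondConfig V, rcWeightW wB q ({a, b, c} : Set V) η * ind {η : BondConfig V | b ∉ cl η.toFinset a ∧ c ∉ cl η.toFinset a ∧ c ∈ cl η.toFinset b} η) + (∑ η : BondConfig V, rcWeightW wA q ({a, b, c} : Set V) η * ind {η : BondConfig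 V | b ∈ cl η.toFinset a ∧ c ∉ cl η.toFinset a} η) * (∑ η : BondConfig V, rcWeightW wB q ({a, b, c} : Set V) η * ind {η : BondConfig V | b ∉ cl η.toFinset a ∧ c ∈ cl η.toFinset a} η) + (∑ η : BondConfig V, rcWeightW wA q ({a, b, c} : Set V) η * ind {η : BondConfig V | b ∉ cl η.toFinset a ∧ c ∈ cl η.toFinset a} η) * (∑ η : BondConfig V, rcWeightW wB q ({a, b, c} : Set V) η * ind {η : BondConfig V | b ∈ cl η.toFinset a ∧ c ∉ cl η.toFinset a} η) := by
  rw [Finset.sum_mul, Finset.sum_congr rfl fun ω _ => pt_T hab hac hbc hsepD w q hw ω]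
  have e1 := sum_weight_inter_mul_sdiff w wA wB (↑DA) hA hA' hB hB'
    (fun x => ind {η : BondConfig V | b ∈ cl η.toFinset a ∧ c ∈ cl η.toFinset a} x * q ^ clusterCount x ({a, b, c} : Set V)) (fun y => q ^ clusterCount y ({a, b, c} : Set V))
  have e2 := sum_weight_inter_mul_sdiff w wA wB (↑DA) hA hA' hB hB'
    (fun x => q ^ clusterCount x ({a, b, c} : Set V)) (fun y => ind {η : BondConfig V | b ∈ cl η.toFinset a ∧ c ∈ cl η.toFinset a} y * q ^ clusterCount y ({a, b, c} : Set V))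
  have e3 := sum_weight_inter_mul_sdiff w wA wB (↑DA) hA hA' hB hB'
    (fun x => ind {η : BondConfig V | b ∈ cl η.toFinset a ∧ c ∈ cl η.toFinset a} x * q ^ clusterCount x ({a, b, c} : Set V)) (fun y => ind {η : BondConfig V | b ∈ cl η.toFinset a ∧ c ∈ cl η.toFinset a} y * q ^ clusterCount y ({a, b, c} : Set V))
  have e4 := sum_weight_inter_mul_sdiff w wA wB (↑DA) hA hA' hB hB'
    (fun x => ind {η : BondConfig V | b ∉ cl η.toFinset a ∧ c ∉ cl η.toFinset a ∧ c ∈ cl η.toFinset b} x * q ^ clusterCount x ({a, b, c} : Set V)) (fun y => (ind {η : BondConfig V | b ∈ cl η.toFinset a ∧ c ∉ cl η.toFinset a} y + ind {η : BondConfig V | b ∉ cl η.toFinset a ∧ c ∈ cl η.toFinset a} y) * q ^ clusterCount y ({a, b, c} : Set V))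
  have e5 := sum_weight_inter_mul_sdiff w wA wB (↑DA) hA hA' hB hB'
    (fun x => (ind {η : BondConfig V | b ∈ cl η.toFinset a ∧ c ∉ cl η.toFinset a} x + ind {η : BondConfig V | b ∉ cl η.toFinset a ∧ c ∈ cl η.toFinset a} x) * q ^ clusterCount x ({a, b, c} : Set V)) (fun y => ind {η : BondConfig V | b ∉ cl η.toFinset a ∧ c ∉ cl η.toFinset a ∧ c ∈ cl η.toFinset b} y * q ^ clusterCount y ({a, b, c} : Set V))
  have e6 := sum_weight_inter_mul_sdiff w wA wB (↑DA) hA hA' hB hB'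
    (fun x => ind {η : BondConfig V | b ∈ cl η.toFinset a ∧ c ∉ cl η.toFinset a} x * q ^ clusterCount x ({a, b, c} : Set V)) (fun y => ind {η : BondConfig V | b ∉ cl η.toFinset a ∧ c ∈ cl η.toFinset a} y * q ^ clusterCount y ({a, b, c} : Set V))
  have e7 := sum_weight_inter_mul_sdiff w wA wB (↑DA) hA hA' hB hB'
    (fun x => ind {η : BondConfig V | b ∉ cl η.toFinset a ∧ c ∈ cl η.toFinset a} x * q ^ clusterCount x ({a, b, c} : Set V)) (fun y => ind {η : BondConfig V | b ∈ cl η.toFinset a ∧ c ∉ cl η.toFinset a} y * q ^ clusterCount y ({a, b, c} : Set V))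
  beta_reduce at e1 e2 e3 e4 e5 e6 e7
  rw [← sum_weight_ind_add_pow wA q _ {η : BondConfig V | b ∈ cl η.toFinset a ∧ c ∉ cl η.toFinset a} {η : BondConfig V | b ∉ cl η.toFinset a ∧ c ∈ cl η.toFinset a}, ← sum_weight_ind_add_pow wB q _ {η : BondConfig V | b ∈ cl η.toFinset a ∧ c ∉ cl η.toFinset a} {η : BondConfig V | b ∉ cl η.toFinset a ∧ c ∈ cl η.toFinset a},
    ← sum_weight_ind_pow wA q _ {η : BondConfig V | b ∈ cl η.toFinset a ∧ c ∈ cl η.toFinset a}, ← sum_weight_ind_pow wB q _ {η : BondConfig V | b ∈ cl η.toFinset a ∧ c ∈ cl η.toFinset a},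
    ← sum_weight_pow wA q, ← sum_weight_pow wB q,
    ← sum_weight_ind_pow wA q _ {η : BondConfig V | b ∉ cl η.toFinset a ∧ c ∉ cl η.toFinset a ∧ c ∈ cl η.toFinset b}, ← sum_weight_ind_pow wB q _ {η : BondConfig V | b ∉ cl η.toFinset a ∧ c ∉ cl η.toFinset a ∧ c ∈ cl η.toFinset b},
    ← sum_weight_ind_pow wA q _ {η : BondConfig V | b ∈ cl η.toFinset a ∧ c ∉ cl η.toFinset a}, ← sum_weight_ind_pow wB q _ {η : BondConfig V | b ∈ cl η.toFinset a ∧ c ∉ cl η.toFinset a},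
    ← sum_weight_ind_pow wA q _ {η : BondConfig V | b ∉ cl η.toFinset a ∧ c ∈ cl η.toFinset a}, ← sum_weight_ind_pow wB q _ {η : BondConfig V | b ∉ cl η.toFinset a ∧ c ∈ cl η.toFinset a},
    ← e1, ← e2, ← e3, ← e4, ← e5, ← e6, ← e7,
    ← Finset.sum_add_distrib, ← Finset.sum_sub_distrib, ← Finset.sum_add_distrib, ← Finset.sum_add_distrib,
    ← Finset.sum_add_distrib, ← Finset.sum_add_distrib]
  refine Finset.sum_congr rfl fun ω _ => by ring

end Sums

end ThreeSum

end Summit.CriticalPhenomena.PercolationContinuityZ3.Theorems
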